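import Summits.SmoothPoincare4.SmoothPoincare4.Theorems.ConvexBisectionAcyclicBisectionExistsDualHandleSeamModelChart
import Literature.Topology.FourManifolds.SmoothEmbeddingCriteria
import HarnessLib

/-!
# Dual handles, XI: the explicit inverse of the model chart
(brick (ii-e) of the sub-goal T3b "the complement of the prefix sub-handlebody is the other piece
with the DUAL suffix handles" of stub `stub_steinRealisation` (NF6), line `modp-braid-orbits` r11,
crux `ConvexBisection.AcyclicBisectionExists`, item stmt-SmoothPoincare4-10508; wave 2, lead c5)

Sequel of `…DualHandleSeamModelChart.lean` (`modelChart D j G a x = ι (seamPt x, seamHeight a x)`,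
smooth on the seam locus `{x_μ ≠ 0, ‖x_λ‖ < 1, 1 - ‖x‖² < a}`).  Here the chart gets its EXPLICIT
INVERSE and is shown to be a smooth embedding with open range on every open subset of the seam locus
— the form in which the long pole of T3b uses it (`Hⱼ ∘ Ξ⁻¹` smooth for the level function of `W₂`;
`F_j = Ξ ∘ 𝓕` a smooth embedding):

* `normSqOfHeight a t = (1 - (a-1) t)/(1 + t)` — `‖x‖²` recovered from the seam height
  (`normSqOfHeight_seamHeight`, `seamHeight_of_norm_sq`);
* `modelChartInv D j bX a (z, t) = (v, √(u - ‖v‖²) θ)`, `(θ, v) = belt-tube coordinates of z`,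
  `u = normSqOfHeight a t` — **the inverse**: `modelChartInv (seamPt x, seamHeight a x) = x`
  (`modelChartInv_seamPt`), hence `injOn_modelChart`; conversely
  `(seamPt, seamHeight) (modelChartInv q) = q` on the open set `invDom` (`seamPt_modelChartInv`,
  `seamHeight_modelChartInv`), and `contMDiffOn_modelChartInv`;
* `image_seam_eq`, `isOpen_invDom`, `isOpen_image_seam` — open subsets of the seam locus have open
  images under `(seamPt, seamHeight)`;
* `helper_modelChartInv_seamPt` (registered).

The smooth-embedding statement itself (`isSmoothEmbedding_modelChart`) is in
`…DualHandleSeamModelChartEmbedding.lean`.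

Everything here is proved; no named facts.

## References
* J. Milnor, *Lectures on the h-cobordism theorem* (1965), Thm. 1.4. [MilnorHCobordism1965]
* J. M. Lee, *Introduction to Smooth Manifolds* (2013), Prop. 5.2, Thm. 4.14. [LeeSmoothManifolds2013]
-/

noncomputable section

-- the prescribed namespace `Summit.<P>.<Sub>.…` duplicates `SmoothPoincare4` (P = Sub)
set_option linter.dupNamespace false

open scoped Manifold ContDiff Topology

namespace Summit.SmoothPoincare4.SmoothPoincare4.Theorems.AcyclicBisectionExists.ModpBraidOrbits

open Set Function Metric Topology
open Literature.Topology.FourManifolds Literature.Topology.FourManifolds.HandleAttachingMap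

/-! ### §1 The norm recovered from the height -/

section Height

/-- `‖x‖²` as a function of the seam height: `(1 - (a-1) t)/(1 + t)`. [folklore] -/
def normSqOfHeight (a t : ℝ) : ℝ := (1 - (a - 1) * t) / (1 + t)

/-- `normSqOfHeight a (seamHeight a x) = ‖x‖²` (`0 < a`, `1 - ‖x‖² < a`). [folklore] -/
theorem normSqOfHeight_seamHeight {a : ℝ} (ha : 0 < a) {x : EuclideanSpace ℝ (Fin 4)} (hx : 1 - ‖x‖ ^ 2 < a) :
    normSqOfHeight a (seamHeight a x) = ‖x‖ ^ 2 := by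
  have hd : 0 < a - 1 + ‖x‖ ^ 2 := by linarith
  have h1 : 1 + (1 - ‖x‖ ^ 2) / (a - 1 + ‖x‖ ^ 2) = a / (a - 1 + ‖x‖ ^ 2) := by
    field_simp; ring
  have h2 : 1 - (a - 1) * ((1 - ‖x‖ ^ 2) / (a - 1 + ‖x‖ ^ 2)) = a * ‖x‖ ^ 2 / (a - 1 + ‖x‖ ^ 2) := by
    field_simp; ring
  unfold normSqOfHeight seamHeight
  rw [h1, h2, div_div_div_cancel_right₀ hd.ne', mul_div_assoc, mul_div_cancel₀ _ ha.ne']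

/-- Conversely `seamHeight a x = t` when `‖x‖² = normSqOfHeight a t` (`0 < a`, `-1 < t`). [folklore] -/
theorem seamHeight_of_norm_sq {a t : ℝ} (ha : 0 < a) (ht : -1 < t) {x : EuclideanSpace ℝ (Fin 4)}
    (hx : ‖x‖ ^ 2 = normSqOfHeight a t) : seamHeight a x = t := by
  have h1 : (0 : ℝ) < 1 + t := by linarith
  unfold seamHeight
  rw [hx, normSqOfHeight, div_eq_iff]
  · field_simp
    ring
  · rw [ne_eq, ← sub_eq_zero.not]
    intro h
    field_simp at h
    nlinarith

/-- `1 - normSqOfHeight a t < a` for `-1 < t`, `0 < a`. [folklore] -/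
theorem one_sub_normSqOfHeight_lt {a t : ℝ} (ha : 0 < a) (ht : -1 < t) : 1 - normSqOfHeight a t < a := by
  have h1 : (0 : ℝ) < 1 + t := by linarith
  have h2 : normSqOfHeight a t = 1 - a * t / (1 + t) := by
    unfold normSqOfHeight; field_simp; ring
  rw [h2, sub_sub_cancel, div_lt_iff₀ h1]
  nlinarith

/-- `-1 < seamHeight a x` (`0 < a`, `1 - ‖x‖² < a`). [folklore] -/
theorem neg_one_lt_seamHeight {a : ℝ} (ha : 0 < a) {x : EuclideanSpace ℝ (Fin 4)} (hx : 1 - ‖x‖ ^ 2 < a) :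
    -1 < seamHeight a x := by
  have hd : 0 < a - 1 + ‖x‖ ^ 2 := by linarith
  unfold seamHeight
  rw [lt_div_iff₀ hd]
  linarith

end Height

/-! ### §2 The inverse of the model chart -/

section Inverse

variable {B : Type} [TopologicalSpace B] [T2Space B] [ChartedSpace (EuclideanHalfSpace 4) B]
  {ι : Type} [Finite ι] {h : ι → HandleAttachingMap 3 2 B}
  {X : Type} [TopologicalSpace X] [ChartedSpace (EuclideanHalfSpace 4) X] [IsManifold (𝓡∂ 4) ∞ X]
  (D : MultiAttachmentData h (𝓡∂ 4) X) (j : ι) (bX : BoundaryData (𝓡∂ 4) X (𝓡 3))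

/-- The belt-tube coordinates `(θ, v)` of a boundary point read in `bX` (inverse of the boundary tube
of the belt map, after `bX ≅` canonical carrier). [folklore] -/
def tubeCoords (z : bX.carrier) : (sphere (0 : EuclideanSpace ℝ (Fin 2)) 1) × EuclideanSpace ℝ (Fin 2) :=
  (beltMap D j).boundaryTube.toHomeo.symm
    ((bX.restrictDiffeomorph (BoundaryManifold.boundaryData 3 X) (Diffeomorph.refl (𝓡∂ 4) X ∞)) z)

/-- **The inverse of the model chart**: `(z, t) ↦ (v, √(u - ‖v‖²) θ)` with `(θ, v)` the belt-tube
coordinates of `z` and `u = normSqOfHeight a t`. [folklore] -/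
def modelChartInv (a : ℝ) (q : bX.carrier × ℝ) : EuclideanSpace ℝ (Fin 4) :=
  lamEmbed (tubeCoords D j bX q.1).2 +
    Real.sqrt (normSqOfHeight a q.2 - ‖(tubeCoords D j bX q.1).2‖ ^ 2) •
      muEmbed ((tubeCoords D j bX q.1).1 : EuclideanSpace ℝ (Fin 2))

/-- `bX ≅ ∂X ≅ bX` (restrictions of the identity) is the identity. [folklore] -/
theorem restrict_refl_restrict_refl (p : (BoundaryManifold.boundaryData 3 X).carrier) :
    bX.restrictDiffeomorph (BoundaryManifold.boundaryData 3 X) (Diffeomorph.refl (𝓡∂ 4) X ∞)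
      ((BoundaryManifold.boundaryData 3 X).restrictDiffeomorph bX (Diffeomorph.refl (𝓡∂ 4) X ∞) p) = p :=
  (BoundaryManifold.boundaryData 3 X).injective_incl (by
    rw [BoundaryData.incl_restrictDiffeomorph, BoundaryData.incl_restrictDiffeomorph]; rfl)

/-- The belt-tube coordinates of the seam point under `x` are `(x̂_μ, x_λ)` (for `‖x_λ‖ < 1`).
[folklore] -/
theorem tubeCoords_seamPt {x : EuclideanSpace ℝ (Fin 4)} (hx : ‖lamPart x‖ < 1) :
    tubeCoords D j bX (seamPt D j bX x) = (muDir x, lamPart x) := by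
  rw [tubeCoords, seamPt, restrict_refl_restrict_refl]
  exact (beltMap D j).boundaryTube.symm_apply_apply
    (((beltMap D j).boundaryTube.mem_source_iff).2 hx)

/-- **`modelChartInv` inverts the chart on the seam locus**:
`modelChartInv (seamPt x, seamHeight a x) = x` for `x_μ ≠ 0`, `‖x_λ‖ < 1`, `1 - ‖x‖² < a`. [folklore] -/
theorem modelChartInv_seamPt {a : ℝ} (ha : 0 < a) {x : EuclideanSpace ℝ (Fin 4)} (hμ : muPart x ≠ 0)
    (hlam : ‖lamPart x‖ < 1) (hxa : 1 - ‖x‖ ^ 2 < a) :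
    modelChartInv D j bX a (seamPt D j bX x, seamHeight a x) = x := by
  have h1 : normSqOfHeight a (seamHeight a x) - ‖lamPart x‖ ^ 2 = ‖muPart x‖ ^ 2 := by
    rw [normSqOfHeight_seamHeight ha hxa, norm_sq_eq_lamPart_muPart]; ring
  simp only [modelChartInv, tubeCoords_seamPt D j bX hlam]
  rw [h1, Real.sqrt_sq (norm_nonneg _), ← muEmbed_smul, norm_smul_muDir hμ, lamEmbed_add_muEmbed]

variable {W : Type} [TopologicalSpace W] [ChartedSpace (EuclideanHalfSpace 4) W]
  [IsManifold (𝓡∂ 4) ∞ W] {bW : BoundaryData (𝓡∂ 4) W (𝓡 3)} [Nonempty bX.carrier]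

/-- **The model chart is injective on the seam locus** `{x_μ ≠ 0, ‖x_λ‖ < 1, 1 - ‖x‖² < a}`.
[folklore] -/
theorem injOn_modelChart (G : BoundaryGlueData bX bW) {a : ℝ} (ha : 0 < a) :
    InjOn (modelChart D j G a) {x | muPart x ≠ 0 ∧ ‖lamPart x‖ < 1 ∧ 1 - ‖x‖ ^ 2 < a} := by
  intro x hx x' hx' heq
  have h1 : (seamPt D j bX x, seamHeight a x) = (seamPt D j bX x', seamHeight a x') :=
    G.d₁.inl_injective (G.d₂.inl_injective heq)
  rw [← modelChartInv_seamPt D j bX ha hx.1 hx.2.1 hx.2.2, h1,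
    modelChartInv_seamPt D j bX ha hx'.1 hx'.2.1 hx'.2.2]

end Inverse

/-! ### §3 Smoothness of the inverse, the right inverse, open images -/

section Smooth

variable {B : Type} [TopologicalSpace B] [T2Space B] [ChartedSpace (EuclideanHalfSpace 4) B]
  {ι : Type} [Finite ι] {h : ι → HandleAttachingMap 3 2 B}
  {X : Type} [TopologicalSpace X] [ChartedSpace (EuclideanHalfSpace 4) X] [IsManifold (𝓡∂ 4) ∞ X]
  (D : MultiAttachmentData h (𝓡∂ 4) X) (j : ι) (bX : BoundaryData (𝓡∂ 4) X (𝓡 3))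

/-- The domain of the inverse: `z` in the belt-tube target, `-1 < t`, and `‖v‖² < normSqOfHeight a t`.
[folklore] -/
def invDom (a : ℝ) : Set (bX.carrier × ℝ) :=
  {q | (bX.restrictDiffeomorph (BoundaryManifold.boundaryData 3 X) (Diffeomorph.refl (𝓡∂ 4) X ∞)) q.1 ∈
      (beltMap D j).boundaryTube.toHomeo.target ∧
    -1 < q.2 ∧ ‖(tubeCoords D j bX q.1).2‖ ^ 2 < normSqOfHeight a q.2}

/-- The belt-tube coordinates are smooth where `z` is in the belt-tube target. [folklore] -/
theorem contMDiffOn_tubeCoords :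
    ContMDiffOn (𝓡 3) ((𝓡 1).prod 𝓘(ℝ, EuclideanSpace ℝ (Fin 2))) ∞ (tubeCoords D j bX)
      {z | (bX.restrictDiffeomorph (BoundaryManifold.boundaryData 3 X) (Diffeomorph.refl (𝓡∂ 4) X ∞)) z ∈
        (beltMap D j).boundaryTube.toHomeo.target} :=
  (beltMap D j).boundaryTube.contMDiffOn_symm.comp
    (bX.restrictDiffeomorph (BoundaryManifold.boundaryData 3 X) (Diffeomorph.refl (𝓡∂ 4) X ∞)).contMDiff.contMDiffOn
    fun _ hz => hz

/-- `normSqOfHeight a` is smooth on `-1 < t`. [folklore] -/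
theorem contDiffOn_normSqOfHeight (a : ℝ) : ContDiffOn ℝ ∞ (normSqOfHeight a) {t | -1 < t} := by
  unfold normSqOfHeight
  exact ContDiffOn.div (contDiffOn_const.sub (contDiffOn_const.mul contDiffOn_id))
    (contDiffOn_const.add contDiffOn_id) fun t ht => by
      simp only [mem_setOf_eq] at ht; show (1 : ℝ) + t ≠ 0; linarith

/-- **The inverse of the model chart is smooth on `invDom`.** [folklore] -/
theorem contMDiffOn_modelChartInv (a : ℝ) :
    ContMDiffOn ((𝓡 3).prod 𝓘(ℝ, ℝ)) 𝓘(ℝ, EuclideanSpace ℝ (Fin 4)) ∞ (modelChartInv D j bX a) (invDom D j bX a) := by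
  haveI : Fact (Module.finrank ℝ (EuclideanSpace ℝ (Fin 2)) = 1 + 1) := ⟨by simp⟩
  have hT : ContMDiffOn ((𝓡 3).prod 𝓘(ℝ, ℝ)) ((𝓡 1).prod 𝓘(ℝ, EuclideanSpace ℝ (Fin 2))) ∞
      (fun q : bX.carrier × ℝ => tubeCoords D j bX q.1) (invDom D j bX a) :=
    (contMDiffOn_tubeCoords D j bX).comp contMDiff_fst.contMDiffOn fun q hq => hq.1
  have hv : ContMDiffOn ((𝓡 3).prod 𝓘(ℝ, ℝ)) 𝓘(ℝ, EuclideanSpace ℝ (Fin 2)) ∞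
      (fun q : bX.carrier × ℝ => (tubeCoords D j bX q.1).2) (invDom D j bX a) :=
    contMDiff_snd.comp_contMDiffOn hT
  have hθ : ContMDiffOn ((𝓡 3).prod 𝓘(ℝ, ℝ)) 𝓘(ℝ, EuclideanSpace ℝ (Fin 2)) ∞
      (fun q : bX.carrier × ℝ => ((tubeCoords D j bX q.1).1 : EuclideanSpace ℝ (Fin 2))) (invDom D j bX a) :=
    ((contMDiff_coe_sphere (n := 1) (E := EuclideanSpace ℝ (Fin 2))).comp contMDiff_fst).comp_contMDiffOn hT
  have hu : ContMDiffOn ((𝓡 3).prod 𝓘(ℝ, ℝ)) 𝓘(ℝ, ℝ) ∞ (fun q : bX.carrier × ℝ => normSqOfHeight a q.2)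
      (invDom D j bX a) :=
    (contDiffOn_normSqOfHeight a).contMDiffOn.comp contMDiff_snd.contMDiffOn fun q hq => hq.2.1
  have hrad : ContMDiffOn ((𝓡 3).prod 𝓘(ℝ, ℝ)) 𝓘(ℝ, ℝ) ∞
      (fun q : bX.carrier × ℝ => normSqOfHeight a q.2 - ‖(tubeCoords D j bX q.1).2‖ ^ 2) (invDom D j bX a) :=
    hu.sub ((contDiff_norm_sq ℝ).contMDiff.comp_contMDiffOn hv)
  have hsqrt : ContMDiffOn 𝓘(ℝ, ℝ) 𝓘(ℝ, ℝ) ∞ Real.sqrt {r : ℝ | 0 < r} := fun r hr =>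
    (Real.contDiffAt_sqrt (ne_of_gt hr)).contMDiffAt.contMDiffWithinAt
  have hsq : ContMDiffOn ((𝓡 3).prod 𝓘(ℝ, ℝ)) 𝓘(ℝ, ℝ) ∞
      (fun q : bX.carrier × ℝ => Real.sqrt (normSqOfHeight a q.2 - ‖(tubeCoords D j bX q.1).2‖ ^ 2))
      (invDom D j bX a) :=
    hsqrt.comp hrad fun q hq => by show (0:ℝ) < _; linarith [hq.2.2]
  exact (contDiff_lamEmbed.contMDiff.comp_contMDiffOn hv).add
    (hsq.smul (contDiff_muEmbed.contMDiff.comp_contMDiffOn hθ))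

/-- **The right inverse**: the parts of `modelChartInv q` (`q ∈ invDom`). [folklore] -/
theorem lamPart_modelChartInv (a : ℝ) (q : bX.carrier × ℝ) :
    lamPart (modelChartInv D j bX a q) = (tubeCoords D j bX q.1).2 := by
  rw [modelChartInv, lamPart_add, lamPart_lamEmbed, lamPart_smul, lamPart_muEmbed, smul_zero, add_zero]

/-- The `μ`-part of the inverse. [folklore] -/
theorem muPart_modelChartInv (a : ℝ) (q : bX.carrier × ℝ) :
    muPart (modelChartInv D j bX a q) =
      Real.sqrt (normSqOfHeight a q.2 - ‖(tubeCoords D j bX q.1).2‖ ^ 2) •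
        ((tubeCoords D j bX q.1).1 : EuclideanSpace ℝ (Fin 2)) := by
  rw [modelChartInv, muPart_add, muPart_lamEmbed, muPart_smul, muPart_muEmbed, zero_add]

/-- The `μ`-part of the inverse is non-zero on `invDom`. [folklore] -/
theorem muPart_modelChartInv_ne_zero (a : ℝ) {q : bX.carrier × ℝ} (hq : q ∈ invDom D j bX a) :
    muPart (modelChartInv D j bX a q) ≠ 0 := by
  rw [muPart_modelChartInv, smul_ne_zero_iff]
  refine ⟨(Real.sqrt_pos.2 (by linarith [hq.2.2])).ne', ?_⟩
  intro h0
  have := norm_eq_of_mem_sphere (tubeCoords D j bX q.1).1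
  rw [h0, norm_zero] at this
  exact zero_ne_one this

/-- The `μ`-direction of the inverse. [folklore] -/
theorem muDir_modelChartInv (a : ℝ) {q : bX.carrier × ℝ} (hq : q ∈ invDom D j bX a) :
    muDir (modelChartInv D j bX a q) = (tubeCoords D j bX q.1).1 := by
  apply Subtype.ext
  have hR := Real.sqrt_pos.2 (by linarith [hq.2.2] : 0 < normSqOfHeight a q.2 - ‖(tubeCoords D j bX q.1).2‖ ^ 2)
  rw [coe_muDir (muPart_modelChartInv_ne_zero D j bX a hq), muPart_modelChartInv, norm_smul,
    Real.norm_of_nonneg hR.le, norm_eq_of_mem_sphere, mul_one, smul_smul, inv_mul_cancel₀ hR.ne', one_smul]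

/-- The norm of the inverse: `‖modelChartInv q‖² = normSqOfHeight a t`. [folklore] -/
theorem norm_modelChartInv_sq (a : ℝ) {q : bX.carrier × ℝ} (hq : q ∈ invDom D j bX a) :
    ‖modelChartInv D j bX a q‖ ^ 2 = normSqOfHeight a q.2 := by
  have hR : 0 ≤ normSqOfHeight a q.2 - ‖(tubeCoords D j bX q.1).2‖ ^ 2 := by linarith [hq.2.2]
  rw [modelChartInv, ← muEmbed_smul, norm_lamEmbed_add_muEmbed_sq, norm_smul, Real.norm_of_nonneg (Real.sqrt_nonneg _),
    norm_eq_of_mem_sphere, mul_one, Real.sq_sqrt hR]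
  ring

/-- **`seamPt ∘ modelChartInv = pr₁` on `invDom`.** [folklore] -/
theorem seamPt_modelChartInv (a : ℝ) {q : bX.carrier × ℝ} (hq : q ∈ invDom D j bX a) :
    seamPt D j bX (modelChartInv D j bX a q) = q.1 := by
  rw [seamPt, muDir_modelChartInv D j bX a hq, lamPart_modelChartInv, Prod.mk.eta, tubeCoords,
    (beltMap D j).boundaryTube.apply_symm_apply hq.1]
  exact bX.injective_incl (by rw [BoundaryData.incl_restrictDiffeomorph, BoundaryData.incl_restrictDiffeomorph]; rfl)

/-- **`seamHeight ∘ modelChartInv = pr₂` on `invDom`** (`0 < a`). [folklore] -/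
theorem seamHeight_modelChartInv {a : ℝ} (ha : 0 < a) {q : bX.carrier × ℝ} (hq : q ∈ invDom D j bX a) :
    seamHeight a (modelChartInv D j bX a q) = q.2 :=
  seamHeight_of_norm_sq ha hq.2.1 (norm_modelChartInv_sq D j bX a hq)

/-- The chart coordinates of the seam locus lie in `invDom`. [folklore] -/
theorem seam_mem_invDom {a : ℝ} (ha : 0 < a) {x : EuclideanSpace ℝ (Fin 4)} (hμ : muPart x ≠ 0)
    (hlam : ‖lamPart x‖ < 1) (hxa : 1 - ‖x‖ ^ 2 < a) :
    (seamPt D j bX x, seamHeight a x) ∈ invDom D j bX a := by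
  refine ⟨?_, neg_one_lt_seamHeight ha hxa, ?_⟩
  · show (bX.restrictDiffeomorph (BoundaryManifold.boundaryData 3 X) (Diffeomorph.refl (𝓡∂ 4) X ∞))
      (seamPt D j bX x) ∈ (beltMap D j).boundaryTube.toHomeo.target
    rw [seamPt, restrict_refl_restrict_refl]
    exact (beltMap D j).boundaryTube.toHomeo.map_source (((beltMap D j).boundaryTube.mem_source_iff).2 hlam)
  · show ‖(tubeCoords D j bX (seamPt D j bX x)).2‖ ^ 2 < normSqOfHeight a (seamHeight a x)
    rw [tubeCoords_seamPt D j bX hlam, normSqOfHeight_seamHeight ha hxa, norm_sq_eq_lamPart_muPart]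
    have := pow_pos (norm_pos_iff.2 hμ) 2
    show ‖lamPart x‖ ^ 2 < _
    linarith

/-- **The image of an open subset of the seam locus under `(seamPt, seamHeight)`** is
`invDom ∩ modelChartInv⁻¹' O`. [folklore] -/
theorem image_seam_eq {a : ℝ} (ha : 0 < a) {O : Set (EuclideanSpace ℝ (Fin 4))}
    (hO : O ⊆ {x | muPart x ≠ 0 ∧ ‖lamPart x‖ < 1 ∧ 1 - ‖x‖ ^ 2 < a}) :
    (fun x => (seamPt D j bX x, seamHeight a x)) '' O = invDom D j bX a ∩ modelChartInv D j bX a ⁻¹' O := by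
  ext q
  constructor
  · rintro ⟨x, hx, rfl⟩
    exact ⟨seam_mem_invDom D j bX ha (hO hx).1 (hO hx).2.1 (hO hx).2.2, by
      show modelChartInv D j bX a _ ∈ O
      rw [modelChartInv_seamPt D j bX ha (hO hx).1 (hO hx).2.1 (hO hx).2.2]; exact hx⟩
  · rintro ⟨hq, hqO⟩
    refine ⟨modelChartInv D j bX a q, hqO, ?_⟩
    show (seamPt D j bX (modelChartInv D j bX a q), seamHeight a (modelChartInv D j bX a q)) = q
    rw [seamPt_modelChartInv D j bX a hq, seamHeight_modelChartInv D j bX ha hq]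

/-- `invDom` is open. [folklore] -/
theorem isOpen_invDom (a : ℝ) : IsOpen (invDom D j bX a) := by
  have h1 : IsOpen {q : bX.carrier × ℝ |
      (bX.restrictDiffeomorph (BoundaryManifold.boundaryData 3 X) (Diffeomorph.refl (𝓡∂ 4) X ∞)) q.1 ∈
        (beltMap D j).boundaryTube.toHomeo.target ∧ -1 < q.2} := by
    refine IsOpen.inter ?_ (isOpen_lt continuous_const continuous_snd)
    exact ((beltMap D j).boundaryTube.toHomeo.open_target.preimage
      (bX.restrictDiffeomorph (BoundaryManifold.boundaryData 3 X) (Diffeomorph.refl (𝓡∂ 4) X ∞)).continuous).preimage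
      continuous_fst
  have h2 : ContinuousOn (fun q : bX.carrier × ℝ => normSqOfHeight a q.2 - ‖(tubeCoords D j bX q.1).2‖ ^ 2)
      {q | (bX.restrictDiffeomorph (BoundaryManifold.boundaryData 3 X) (Diffeomorph.refl (𝓡∂ 4) X ∞)) q.1 ∈
        (beltMap D j).boundaryTube.toHomeo.target ∧ -1 < q.2} := by
    refine (((contDiffOn_normSqOfHeight a).continuousOn.comp continuous_snd.continuousOn fun q hq => hq.2)).sub
      ((continuous_norm.pow 2).comp_continuousOn (continuous_snd.comp_continuousOn
        ((contMDiffOn_tubeCoords D j bX).continuousOn.comp continuous_fst.continuousOn fun q hq => hq.1)))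
  have h3 : invDom D j bX a = {q : bX.carrier × ℝ |
      (bX.restrictDiffeomorph (BoundaryManifold.boundaryData 3 X) (Diffeomorph.refl (𝓡∂ 4) X ∞)) q.1 ∈
        (beltMap D j).boundaryTube.toHomeo.target ∧ -1 < q.2} ∩
      (fun q : bX.carrier × ℝ => normSqOfHeight a q.2 - ‖(tubeCoords D j bX q.1).2‖ ^ 2) ⁻¹' Ioi 0 := by
    ext q; simp only [invDom, mem_setOf_eq, mem_inter_iff, mem_preimage, mem_Ioi, sub_pos]; tauto
  rw [h3]
  exact h2.isOpen_inter_preimage h1 isOpen_Ioi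

/-- **Open subsets of the seam locus have open images under `(seamPt, seamHeight)`.** [folklore] -/
theorem isOpen_image_seam {a : ℝ} (ha : 0 < a) {O : Set (EuclideanSpace ℝ (Fin 4))} (hOo : IsOpen O)
    (hO : O ⊆ {x | muPart x ≠ 0 ∧ ‖lamPart x‖ < 1 ∧ 1 - ‖x‖ ^ 2 < a}) :
    IsOpen ((fun x => (seamPt D j bX x, seamHeight a x)) '' O) := by
  rw [image_seam_eq D j bX ha hO]
  exact (contMDiffOn_modelChartInv D j bX a).continuousOn.isOpen_inter_preimage (isOpen_invDom D j bX a) hOo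

/-- **Registered helper `helper_modelChartInv_seamPt` (brick (ii-e) of T3b, sub-goal of NF6
`stub_steinRealisation`, wave 2, lead c5): the explicit inverse of the model chart** —
`modelChartInv (seamPt x, seamHeight a x) = x` on the seam locus. [cite: MilnorHCobordism1965, Thm. 1.4] -/
theorem helper_modelChartInv_seamPt : ∀ {B : Type} [TopologicalSpace B] [T2Space B] [ChartedSpace (EuclideanHalfSpace 4) B] {ι : Type} [Finite ι] {h : ι → Literature.Topology.FourManifolds.HandleAttachingMap 3 2 B} {X : Type} [TopologicalSpace X] [ChartedSpace (EuclideanHalfSpace 4) X] [IsManifold (𝓡∂ 4) ∞ X] (D : Literature.Topology.FourManifolds.HandleAttachingMap.MultiAttachmentData h (𝓡∂ 4) X) (j : ι) (bX : Literature.Topology.FourManifolds.BoundaryData (𝓡∂ 4) X (𝓡 3)) {a : ℝ}, 0 < a → ∀ {x : EuclideanSpace ℝ (Fin 4)}, Literature.Topology.FourManifolds.muPart x ≠ 0 → ‖Literature.Topology.FourManifolds.lamPart x‖ < 1 → 1 - ‖x‖ ^ 2 < a → Summit.SmoothPoincare4.SmoothPoincare4.Theorems.AcyclicBisectionExists.ModpBraidOrbits.modelChartInv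 D j bX a (Summit.SmoothPoincare4.SmoothPoincare4.Theorems.AcyclicBisectionExists.ModpBraidOrbits.seamPt D j bX x, Summit.SmoothPoincare4.SmoothPoincare4.Theorems.AcyclicBisectionExists.ModpBraidOrbits.seamHeight a x) = x :=
  fun D j bX _ ha _ hμ hlam hxa => modelChartInv_seamPt D j bX ha hμ hlam hxa

end Smooth

end Summit.SmoothPoincare4.SmoothPoincare4.Theorems.AcyclicBisectionExists.ModpBraidOrbits

end
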